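import Literature.Probability.LatticeModels.ExplorationVolume
import Literature.Probability.LatticeModels.GibbsSpecification
import Literature.Probability.Percolation.Percolation
import HarnessLib

/-!
# Percolation events of spin configurations: clusters of constant spin

Topic `Probability/LatticeModels`. The percolation vocabulary of Georgii–Higuchi 2000, §2
(p. 4): "Given any configuration `ω ∈ Ω`, we consider the set `S⁺(ω) = {x ∈ ℤ² : ω(x) = +1}` of
`+` spins. A path (resp. cluster) in `S⁺(ω)` is called a `+`path (resp. `+`cluster) … Let `E⁺`
denote the event that there exists an infinite `+`cluster", phrased for an arbitrary locally
finite graph `G` and spin value `s ∈ {±1}` by transporting the tree's site-percolation vocabulary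
(`Percolation.siteCluster`, `Percolation.sitePercolatesAt`) along the map `spinSites s`.

* `spinSites s ω = {x | ω x = s}` (`S^±(ω)`), its measurability and monotonicity;
* `existsInfCluster G s = {ω | ∃ x, spinSites s ω ∈ sitePercolatesAt G x}` (`E^±`);
* `measurableSet_cylinderEvents_of_forall_eq` — an event of `{±1}^V` decided by the spins in a
  finite set `K` belongs to `𝓕_K`;
* `measurableSet_explVolume_spinSites_eq` — the exploration volume of `ExplorationVolume` with
  passable set `S⁺(ω)` is *determined from outside* in the measurable sense
  `{explVolume = Γ} ∈ 𝓕_{Γᶜ}` (the hypothesis of the strong Markov property,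
  `GibbsStrongMarkov`), and `eq_neg_one_of_mem_outerBoundary_explVolume` — its outer boundary
  carries `-` spins.

## References

* H.-O. Georgii, Y. Higuchi, J. Math. Phys. 41 (2000) 1153–1169, §2, p. 4 [GeorgiiHiguchi2000].
-/

noncomputable section

open MeasureTheory

namespace Literature.Probability.LatticeModels

variable {V : Type*}

/-! ### The sites of a given spin -/

/-- `S^s(ω) = {x | ω(x) = s}`, the set of sites carrying the spin `s` (Georgii–Higuchi 2000, §2,
p. 4, `S⁺(ω)`), as a site configuration (`Percolation.SiteConfig V = Set V`). [cite: GeorgiiHiguchi2000, §2 p. 4] -/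
def spinSites (s : ℤˣ) (ω : SpinConfig V) : Set V := {x | ω x = s}

/-- Membership in `S^s(ω)`. [cite: GeorgiiHiguchi2000, §2 p. 4] -/
@[simp] theorem mem_spinSites {s : ℤˣ} {ω : SpinConfig V} {x : V} : x ∈ spinSites s ω ↔ ω x = s :=
  Iff.rfl

/-- `ω ↦ S^s(ω)` is measurable (product σ-algebras). [cite: GeorgiiHiguchi2000, §2 p. 4] -/
theorem measurable_spinSites (s : ℤˣ) : Measurable (spinSites (V := V) s) := by
  refine measurable_set_iff.2 fun x => ?_
  refine measurable_to_prop ?_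
  have : (fun ω : SpinConfig V => x ∈ spinSites s ω) ⁻¹' {True} = {ω | ω x = s} := by
    ext ω; simp
  rw [this]
  have hm : Measurable fun ω : SpinConfig V => ω x := measurable_pi_apply x
  exact hm (MeasurableSet.singleton s)

/-- A site not carrying `+1` carries `-1`. [folklore] -/
theorem eq_neg_one_of_ne_one {u : ℤˣ} (hu : u ≠ 1) : u = -1 := by
  rcases Int.units_eq_one_or u with h | h
  · exact absurd h hu
  · exact h

/-- `S⁺` is increasing in the configuration (coordinatewise order on `{±1}^V`). [cite: GeorgiiHiguchi2000, §2 p. 4] -/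
theorem spinSites_one_mono {ω ω' : SpinConfig V} (h : ω ≤ ω') : spinSites 1 ω ⊆ spinSites 1 ω' := by
  intro x hx
  rw [mem_spinSites] at hx ⊢
  have h1 : ω x ≤ ω' x := h x
  rw [hx] at h1
  by_contra hne
  rw [eq_neg_one_of_ne_one hne] at h1
  exact absurd h1 (by decide)

/-! ### Existence of an infinite cluster of constant spin -/

/-- `E^s`: there is an infinite `s`-cluster, i.e. some site lies in an infinite cluster of the
subgraph of `G` induced on `S^s(ω)` (Georgii–Higuchi 2000, §2, p. 4: "Let `E⁺` denote the event
that there exists an infinite `+`cluster"). [cite: GeorgiiHiguchi2000, §2 p. 4] -/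
def existsInfCluster (G : SimpleGraph V) (s : ℤˣ) : Set (SpinConfig V) :=
  {ω | ∃ x, spinSites s ω ∈ Percolation.sitePercolatesAt G x}

/-- Membership in `E^s`. [cite: GeorgiiHiguchi2000, §2 p. 4] -/
theorem mem_existsInfCluster_iff {G : SimpleGraph V} {s : ℤˣ} {ω : SpinConfig V} :
    ω ∈ existsInfCluster G s ↔ ∃ x, (Percolation.siteCluster G (spinSites s ω) x).Infinite :=
  Iff.rfl

/-- If the `s`-cluster of some site is infinite then `E^s` occurs. [cite: GeorgiiHiguchi2000, §2 p. 4] -/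
theorem mem_existsInfCluster_of_infinite {G : SimpleGraph V} {s : ℤˣ} {ω : SpinConfig V} {x : V}
    (h : (Percolation.siteCluster G (spinSites s ω) x).Infinite) : ω ∈ existsInfCluster G s :=
  ⟨x, h⟩

/-! ### Events decided by finitely many spins -/

/-- **An event of `{±1}^V` decided by the spins in a finite set `K` belongs to `𝓕_K`**
(`cylinderEvents ↑K`): it is the preimage under the (measurable) restriction to `K` of a subset
of the countable discrete space `K → {±1}`. [folklore] -/
theorem measurableSet_cylinderEvents_of_forall_eq {K : Finset V} {A : Set (SpinConfig V)}
    (h : ∀ ω ω' : SpinConfig V, (∀ x ∈ K, ω x = ω' x) → (ω ∈ A ↔ ω' ∈ A)) :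
    MeasurableSet[cylinderEvents (X := fun _ : V => ℤˣ) (↑K : Set V)] A := by
  set r : SpinConfig V → ((↑K : Set V) → ℤˣ) := Set.restrict (↑K : Set V) with hr
  have hrm : Measurable[cylinderEvents (X := fun _ : V => ℤˣ) (↑K : Set V)] r :=
    measurable_restrict_cylinderEvents (X := fun _ : V => ℤˣ) (↑K : Set V)
  have hA : A = r ⁻¹' (r '' A) := by
    refine Set.Subset.antisymm (Set.subset_preimage_image r A) fun ω hω => ?_
    obtain ⟨ω', hω'A, hωω'⟩ := hω
    refine (h ω ω' fun x hx => ?_).2 hω'A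
    have := congrFun hωω' ⟨x, Finset.mem_coe.2 hx⟩
    simpa [hr] using this.symm
  rw [hA]
  exact hrm ((Set.to_countable _).measurableSet)

/-! ### The exploration volume of the `+` spins -/

section Exploration

variable {G : SimpleGraph V}

/-- **The exploration volume of the `+` spins is determined from outside**: for every finite
volume `Λ` and candidate `Γ`, the event `{explVolume G Λ S⁺(ω) = Γ}` belongs to `𝓕_{Γᶜ}` (it is
decided by the spins in `Λ \ Γ`, `explVolume_eq_iff`) — the measurability hypothesis of the
strong Markov property (Georgii–Higuchi 2000, proof of Lemma 2.1: "By maximality, `Γ` is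
determined from outside"). [cite: GeorgiiHiguchi2000, Lemma 2.1 (proof, pp. 4–5)] -/
theorem measurableSet_explVolume_spinSites_eq [DecidableEq V] (Λ Γ : Finset V) :
    MeasurableSet[cylinderEvents (X := fun _ : V => ℤˣ) ((↑Γ : Set V)ᶜ)]
      {ω : SpinConfig V | explVolume G Λ (spinSites 1 ω) = Γ} := by
  have hK : MeasurableSet[cylinderEvents (X := fun _ : V => ℤˣ) (↑(Λ \ Γ) : Set V)]
      {ω : SpinConfig V | explVolume G Λ (spinSites 1 ω) = Γ} := by
    refine measurableSet_cylinderEvents_of_forall_eq fun ω ω' hωω' => ?_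
    simp only [Set.mem_setOf_eq]
    rw [explVolume_eq_iff (T := spinSites 1 ω), explVolume_eq_iff (T := spinSites 1 ω')]
    have hT : spinSites 1 ω ∩ (↑Λ \ ↑Γ) = spinSites 1 ω' ∩ (↑Λ \ ↑Γ) := by
      ext x
      simp only [Set.mem_inter_iff, mem_spinSites, Set.mem_sdiff, Finset.mem_coe]
      constructor
      · rintro ⟨hx, hxΛ, hxΓ⟩
        exact ⟨(hωω' x (Finset.mem_sdiff.2 ⟨hxΛ, hxΓ⟩)) ▸ hx, hxΛ, hxΓ⟩
      · rintro ⟨hx, hxΛ, hxΓ⟩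
        exact ⟨(hωω' x (Finset.mem_sdiff.2 ⟨hxΛ, hxΓ⟩)).symm ▸ hx, hxΛ, hxΓ⟩
    rw [hT]
  refine cylinderEvents_mono (fun x hx => ?_) _ hK
  simp only [Finset.coe_sdiff, Set.mem_sdiff, Finset.mem_coe] at hx
  exact hx.2

/-- **The outer boundary of the `+`exploration volume is `-`** (Georgii–Higuchi 2000, proof of
Lemma 2.1: the enclosing `-∗`circuit; here `not_mem_of_adj_explVolume`). [cite: GeorgiiHiguchi2000, Lemma 2.1 (proof, pp. 4–5)] -/
theorem eq_neg_one_of_mem_outerBoundary_explVolume [DecidableEq V] [G.LocallyFinite]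
    (Λ : Finset V) (ω : SpinConfig V) {z : V}
    (hz : z ∈ outerBoundary G (explVolume G Λ (spinSites 1 ω))) : ω z = -1 := by
  rw [mem_outerBoundary_iff] at hz
  obtain ⟨hzΓ, y, hy, hadj⟩ := hz
  have := not_mem_of_adj_explVolume hy hzΓ hadj.symm
  exact eq_neg_one_of_ne_one this.2

/-- The exploration volume grows with the volume: a site of `Λ ⊆ Λ'` which cannot exit `Λ`
through `+` sites cannot exit `Λ'` either (an exit path from `Λ'` first exits `Λ`). [cite: GeorgiiHiguchi2000, Lemma 2.1 (proof, pp. 4–5)] -/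
theorem explVolume_mono_volume {Λ Λ' : Finset V} (hΛ : Λ ⊆ Λ') (T : Set V) :
    explVolume G Λ T ⊆ explVolume G Λ' T := by
  intro y hy
  rw [mem_explVolume_iff] at hy ⊢
  refine ⟨hΛ hy.1, fun hex => hy.2 ?_⟩
  -- an exit path from `Λ'` starting in `Λ` contains an exit path from `Λ`
  suffices key : ∀ v, Exitable G Λ' T v → v ∈ Λ → Exitable G Λ T v from key y hex hy.1
  intro v hv
  induction hv with
  | @base v z _ hz hadj => exact fun hvΛ => .base hvΛ (fun h => hz (hΛ h)) hadj
  | @step v t _ ht hadj _ ih =>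
    intro hvΛ
    by_cases htΛ : t ∈ Λ
    · exact .step hvΛ ht hadj (ih htΛ)
    · exact .base hvΛ htΛ hadj

end Exploration

end Literature.Probability.LatticeModels
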